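import Summits.QuantumAdvantage.QuantumAdvantage.Theorems.CompositeFrameBound.Negative.LoadBearing

/-!
# `SymplecticPurity.CompositeFrameBound` (stmt-QuantumAdvantage-10730) — Schatten form of the cut purity (I)

Helper file (prover, line `Sketch`, `--supports stmt-QuantumAdvantage-10730`).  Pure linear algebra
behind the TORUS THEOREM of the line (`Cruxes/CompositeFrameBound/TorusTheorem.md`, ingredient (S)):
the 4-fold agreement sum `cutPurity ψ k` (= `Tr ρ²_{wires<k}`) is the value on the diagonal of a
4-linear form `fourLin k a b c d`, which in low/high coordinates (`glue`, `gram`) is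
`Σ_{l₁l₂} X_{l₁l₂} Y_{l₂l₁}` with `X = M_a M_b†`, `Y = M_c M_d†` (`fourLin_eq_sum_gram`); two
Cauchy–Schwarz steps give `‖fourLin a b c d‖ ≤ (P a · P b · P c · P d)^{1/4}` with
`P ψ = ‖cutPurity ψ k‖` (`norm_fourLin_le`, `norm_fourLin_le_of_le`) — i.e. `ψ ↦ P(ψ)^{1/4}` is
the Schatten-4 norm of the amplitude matrix.  The definitions (`splitEquiv`, `glue`, `fourLin`, `gram`, `gramH`, `schatten`) are at the top of this file.  Part II (`…SchattenSum.lean`) derives its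
subadditivity over finite superpositions.  No flatness, no Paulis here.
-/

set_option linter.dupNamespace false -- D-0017: single-problem summit ⇒ `QuantumAdvantage.QuantumAdvantage` by design

noncomputable section

namespace Summit.QuantumAdvantage.QuantumAdvantage.Theorems.SymplecticPurity.CompositeFrameBound

open Literature.Computability.Cryptography Literature.Computability.QuantumComplexity Matrix Finset
open Summit.QuantumAdvantage.QuantumAdvantage.Theorems.CompositeFrameBound.Negative

variable {N : ℕ}

/-! ## Low/high coordinates of a linear cut -/

/-- The wires below the cut. -/
abbrev LowIdx (N k : ℕ) : Type := {i : Fin N // i.val < k}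
/-- The wires at or above the cut. -/
abbrev HighIdx (N k : ℕ) : Type := {i : Fin N // ¬ i.val < k}

/-- Splitting a basis label into its low and high parts (restriction). -/
def splitEquiv (N k : ℕ) : QReg N ≃ (LowIdx N k → Bool) × (HighIdx N k → Bool) :=
  Equiv.piEquivPiSubtypeProd (fun i : Fin N => i.val < k) (fun _ => Bool)

/-- Gluing a low part and a high part. -/
def glue (k : ℕ) (l : LowIdx N k → Bool) (h : HighIdx N k → Bool) : QReg N :=
  (splitEquiv N k).symm (l, h)

/-- Pointwise formula for `glue`. -/
theorem glue_apply (k : ℕ) (l : LowIdx N k → Bool) (h : HighIdx N k → Bool) (i : Fin N) :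
    glue k l h i = if hi : i.val < k then l ⟨i, hi⟩ else h ⟨i, hi⟩ := rfl

/-- `glue` restricted to the low wires. -/
theorem glue_apply_low (k : ℕ) (l : LowIdx N k → Bool) (h : HighIdx N k → Bool) (i : LowIdx N k) :
    glue k l h i.1 = l i := by
  rw [glue_apply, dif_pos i.2]

/-- `glue` restricted to the high wires. -/
theorem glue_apply_high (k : ℕ) (l : LowIdx N k → Bool) (h : HighIdx N k → Bool) (i : HighIdx N k) :
    glue k l h i.1 = h i := by
  rw [glue_apply, dif_neg i.2]

/-- Every label is a glue (of its own restrictions). -/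
theorem glue_split (k : ℕ) (x : QReg N) :
    glue k ((splitEquiv N k) x).1 ((splitEquiv N k) x).2 = x := by
  rw [glue, Prod.mk.eta, Equiv.symm_apply_apply]

/-! ## The 4-linear form behind the 4-fold agreement sum -/

/-- The 4-linear (linear in `a, c`, conjugate-linear in `b, d`) agreement form; `cutPurity ψ k` is
its diagonal value `fourLin k ψ ψ ψ ψ`. -/
def fourLin (k : ℕ) (a b c d : QReg N → ℂ) : ℂ :=
  ∑ x₁ : QReg N, ∑ x₂ : QReg N, ∑ x₃ : QReg N, ∑ x₄ : QReg N,
    (if (∀ i, k ≤ i.val → x₁ i = x₂ i) ∧ (∀ i, i.val < k → x₂ i = x₃ i) ∧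
        (∀ i, k ≤ i.val → x₃ i = x₄ i) ∧ (∀ i, i.val < k → x₄ i = x₁ i)
      then a x₁ * star (b x₂) * c x₃ * star (d x₄) else 0)

/-- The purity is the diagonal of the 4-linear form. -/
theorem cutPurity_eq_fourLin (ψ : QReg N → ℂ) (k : ℕ) : cutPurity ψ k = fourLin k ψ ψ ψ ψ := rfl

/-- The Gram entry `(M_a M_b†)_{l₁ l₂} = Σ_h a(l₁,h) conj b(l₂,h)`. -/
def gram (k : ℕ) (a b : QReg N → ℂ) (l₁ l₂ : LowIdx N k → Bool) : ℂ :=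
  ∑ h : HighIdx N k → Bool, a (glue k l₁ h) * star (b (glue k l₂ h))

/-- The other Gram entry `(M_a† M_a)`-type: `Σ_l a(l,h) conj b(l,h')`. -/
def gramH (k : ℕ) (a b : QReg N → ℂ) (h₁ h₂ : HighIdx N k → Bool) : ℂ :=
  ∑ l : LowIdx N k → Bool, a (glue k l h₁) * star (b (glue k l h₂))

/-- The Schatten-4 quasi-norm `q ψ = ‖cutPurity ψ k‖^{1/4}`, written as `√√`. [folklore] -/
def schatten (k : ℕ) (ψ : QReg N → ℂ) : ℝ := Real.sqrt (Real.sqrt ‖cutPurity ψ k‖)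


/-- Summing over labels is summing over (low, high) pairs. -/
theorem sum_eq_sum_glue (k : ℕ) (F : QReg N → ℂ) :
    ∑ x, F x = ∑ l : LowIdx N k → Bool, ∑ h : HighIdx N k → Bool, F (glue k l h) := by
  rw [← Fintype.sum_prod_type']
  exact (Fintype.sum_equiv (splitEquiv N k).symm _ _ (fun p => rfl)).symm

/-- Agreement off the cut between two glued labels is equality of the high parts. -/
theorem agree_high_iff (k : ℕ) (l₁ l₂ : LowIdx N k → Bool) (h₁ h₂ : HighIdx N k → Bool) :
    (∀ i : Fin N, k ≤ i.val → glue k l₁ h₁ i = glue k l₂ h₂ i) ↔ h₁ = h₂ := by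
  constructor
  · intro H
    funext i
    have := H i.1 (Nat.le_of_not_lt i.2)
    rwa [glue_apply_high, glue_apply_high] at this
  · rintro rfl i hi
    have hi' : ¬ i.val < k := Nat.not_lt.2 hi
    rw [glue_apply, glue_apply, dif_neg hi', dif_neg hi']

/-- Agreement on the cut between two glued labels is equality of the low parts. -/
theorem agree_low_iff (k : ℕ) (l₁ l₂ : LowIdx N k → Bool) (h₁ h₂ : HighIdx N k → Bool) :
    (∀ i : Fin N, i.val < k → glue k l₁ h₁ i = glue k l₂ h₂ i) ↔ l₁ = l₂ := by
  constructor
  · intro H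
    funext i
    have := H i.1 i.2
    rwa [glue_apply_low, glue_apply_low] at this
  · rintro rfl i hi
    rw [glue_apply, glue_apply, dif_pos hi, dif_pos hi]

/-- **The agreement form in coordinates**: `fourLin a b c d = Σ_{l₁ l₂} (M_aM_b†)_{l₁l₂} (M_cM_d†)_{l₂l₁}`. -/
theorem fourLin_eq_sum_gram (k : ℕ) (a b c d : QReg N → ℂ) :
    fourLin k a b c d = ∑ l₁ : LowIdx N k → Bool, ∑ l₂ : LowIdx N k → Bool,
      gram k a b l₁ l₂ * gram k c d l₂ l₁ := by
  classical
  unfold fourLin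
  -- pass to (low, high) coordinates in all four variables
  rw [sum_eq_sum_glue k]
  simp only [sum_eq_sum_glue k (fun x₃ => ∑ x₄, _), sum_eq_sum_glue k (fun x₄ => ite _ _ _)]
  simp only [agree_high_iff, agree_low_iff]
  -- now: Σ l₁ h₁ l₂ h₂ l₃ h₃ l₄ h₄ [h₁ = h₂ ∧ l₂ = l₃ ∧ h₃ = h₄ ∧ l₄ = l₁] …
  have step : ∀ (l₁ : LowIdx N k → Bool) (h₁ : HighIdx N k → Bool),
      (∑ l₂ : LowIdx N k → Bool, ∑ h₂ : HighIdx N k → Bool, ∑ l₃ : LowIdx N k → Bool,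
        ∑ h₃ : HighIdx N k → Bool, ∑ l₄ : LowIdx N k → Bool, ∑ h₄ : HighIdx N k → Bool,
        if h₁ = h₂ ∧ l₂ = l₃ ∧ h₃ = h₄ ∧ l₄ = l₁ then
          a (glue k l₁ h₁) * star (b (glue k l₂ h₂)) * c (glue k l₃ h₃) * star (d (glue k l₄ h₄))
        else 0) =
      ∑ l₂ : LowIdx N k → Bool, ∑ h₃ : HighIdx N k → Bool,
        a (glue k l₁ h₁) * star (b (glue k l₂ h₁)) * c (glue k l₂ h₃) * star (d (glue k l₁ h₃)) := by
    intro l₁ h₁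
    refine Finset.sum_congr rfl fun l₂ _ => ?_
    rw [Finset.sum_eq_single h₁]
    · rw [Finset.sum_eq_single l₂]
      · refine Finset.sum_congr rfl fun h₃ _ => ?_
        rw [Finset.sum_eq_single l₁]
        · rw [Finset.sum_eq_single h₃]
          · simp
          · intro h₄ _ hne; rw [if_neg]; exact fun H => hne H.2.2.1.symm
          · intro hn; exact absurd (Finset.mem_univ _) hn
        · intro l₄ _ hne
          apply Finset.sum_eq_zero; intro h₄ _; rw [if_neg]; exact fun H => hne H.2.2.2
        · intro hn; exact absurd (Finset.mem_univ _) hn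
      · intro l₃ _ hne
        apply Finset.sum_eq_zero; intro h₃ _; apply Finset.sum_eq_zero; intro l₄ _
        apply Finset.sum_eq_zero; intro h₄ _; rw [if_neg]; exact fun H => hne H.2.1.symm
      · intro hn; exact absurd (Finset.mem_univ _) hn
    · intro h₂ _ hne
      apply Finset.sum_eq_zero; intro l₃ _; apply Finset.sum_eq_zero; intro h₃ _
      apply Finset.sum_eq_zero; intro l₄ _; apply Finset.sum_eq_zero; intro h₄ _
      rw [if_neg]; exact fun H => hne H.1.symm
    · intro hn; exact absurd (Finset.mem_univ _) hn
  simp only [step]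
  -- regroup: Σ l₁ h₁ l₂ h₃ (a b̄)(c d̄) = Σ l₁ l₂ (Σ h₁ a b̄) (Σ h₃ c d̄)
  refine Finset.sum_congr rfl fun l₁ _ => ?_
  rw [Finset.sum_comm]
  refine Finset.sum_congr rfl fun l₂ _ => ?_
  rw [gram, gram, Finset.sum_mul_sum]
  refine Finset.sum_congr rfl fun h₁ _ => Finset.sum_congr rfl fun h₃ _ => ?_
  ring

/-- Swapping the order of the two Cauchy–Schwarz pairings (complex form):
`Σ_{l₁l₂} (M_aM_b†)_{l₁l₂} conj (M_aM_b†)_{l₁l₂} = Σ_{h h'} (M_a†M_a)_{hh'} · conj (M_b†M_b)_{hh'}`. -/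
theorem sum_gram_mul_star_eq (k : ℕ) (a b : QReg N → ℂ) :
    ∑ l₁ : LowIdx N k → Bool, ∑ l₂ : LowIdx N k → Bool, gram k a b l₁ l₂ * star (gram k a b l₁ l₂) =
      ∑ h : HighIdx N k → Bool, ∑ h' : HighIdx N k → Bool,
        gramH k a a h h' * star (gramH k b b h h') := by
  simp only [gram, gramH, star_sum, star_mul', star_star, Finset.sum_mul_sum]
  -- both sides are Σ over l₁ l₂ h h' of a(l₁h) b̄(l₂h) ā(l₁h') b(l₂h'); reorder
  calc ∑ l₁ : LowIdx N k → Bool, ∑ l₂ : LowIdx N k → Bool, ∑ h : HighIdx N k → Bool,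
        ∑ h' : HighIdx N k → Bool,
        a (glue k l₁ h) * star (b (glue k l₂ h)) * (star (a (glue k l₁ h')) * b (glue k l₂ h'))
      = ∑ l₁ : LowIdx N k → Bool, ∑ h : HighIdx N k → Bool, ∑ h' : HighIdx N k → Bool,
          ∑ l₂ : LowIdx N k → Bool,
          a (glue k l₁ h) * star (b (glue k l₂ h)) * (star (a (glue k l₁ h')) * b (glue k l₂ h')) := by
        refine Finset.sum_congr rfl fun l₁ _ => ?_
        rw [Finset.sum_comm]
        refine Finset.sum_congr rfl fun h _ => ?_
        rw [Finset.sum_comm]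
    _ = ∑ h : HighIdx N k → Bool, ∑ h' : HighIdx N k → Bool, ∑ l₁ : LowIdx N k → Bool,
          ∑ l₂ : LowIdx N k → Bool,
          a (glue k l₁ h) * star (b (glue k l₂ h)) * (star (a (glue k l₁ h')) * b (glue k l₂ h')) := by
        rw [Finset.sum_comm]
        refine Finset.sum_congr rfl fun h _ => ?_
        rw [Finset.sum_comm]
    _ = _ := by
        refine Finset.sum_congr rfl fun h _ => Finset.sum_congr rfl fun h' _ => ?_
        refine Finset.sum_congr rfl fun l₁ _ => Finset.sum_congr rfl fun l₂ _ => ?_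
        ring

/-- Real form: `Σ_{l₁l₂} |(M_aM_b†)_{l₁l₂}|² = ‖Σ_{h h'} (M_a†M_a)_{hh'} conj (M_b†M_b)_{hh'}‖`. -/
theorem sum_norm_gram_sq_eq (k : ℕ) (a b : QReg N → ℂ) :
    ∑ l₁ : LowIdx N k → Bool, ∑ l₂ : LowIdx N k → Bool, ‖gram k a b l₁ l₂‖ ^ 2 =
      ‖∑ h : HighIdx N k → Bool, ∑ h' : HighIdx N k → Bool, gramH k a a h h' * star (gramH k b b h h')‖ := by
  rw [← sum_gram_mul_star_eq]
  have hsq : ∀ l₁ l₂ : LowIdx N k → Bool, gram k a b l₁ l₂ * star (gram k a b l₁ l₂) =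
      ((‖gram k a b l₁ l₂‖ ^ 2 : ℝ) : ℂ) := by
    intro l₁ l₂
    rw [Complex.star_def, Complex.mul_conj, Complex.normSq_eq_norm_sq, Complex.ofReal_pow]
  simp only [hsq, ← Complex.ofReal_sum]
  rw [Complex.norm_real, Real.norm_of_nonneg]
  exact Finset.sum_nonneg fun _ _ => Finset.sum_nonneg fun _ _ => sq_nonneg _

/-- The purity in low coordinates: `‖cutPurity ψ k‖ = Σ_{l₁ l₂} |(M_ψ M_ψ†)_{l₁l₂}|²`. -/
theorem norm_cutPurity_eq_sum_gram (k : ℕ) (ψ : QReg N → ℂ) :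
    ‖cutPurity ψ k‖ = ∑ l₁ : LowIdx N k → Bool, ∑ l₂ : LowIdx N k → Bool, ‖gram k ψ ψ l₁ l₂‖ ^ 2 := by
  have h1 : cutPurity ψ k = ((∑ l₁ : LowIdx N k → Bool, ∑ l₂ : LowIdx N k → Bool,
      ‖gram k ψ ψ l₁ l₂‖ ^ 2 : ℝ) : ℂ) := by
    rw [cutPurity_eq_fourLin, fourLin_eq_sum_gram]
    push_cast
    refine Finset.sum_congr rfl fun l₁ _ => Finset.sum_congr rfl fun l₂ _ => ?_
    have hswap : gram k ψ ψ l₂ l₁ = star (gram k ψ ψ l₁ l₂) := by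
      simp only [gram, star_sum, star_mul', star_star]
      exact Finset.sum_congr rfl fun h _ => by ring
    rw [hswap, Complex.star_def, Complex.mul_conj, Complex.normSq_eq_norm_sq, Complex.ofReal_pow]
  rw [h1, Complex.norm_real, Real.norm_of_nonneg]
  exact Finset.sum_nonneg fun _ _ => Finset.sum_nonneg fun _ _ => sq_nonneg _

/-- The purity in high coordinates: `‖cutPurity ψ k‖ = Σ_{h h'} |(M_ψ† M_ψ)_{hh'}|²`. -/
theorem norm_cutPurity_eq_sum_gramH (k : ℕ) (ψ : QReg N → ℂ) :
    ‖cutPurity ψ k‖ = ∑ h : HighIdx N k → Bool, ∑ h' : HighIdx N k → Bool, ‖gramH k ψ ψ h h'‖ ^ 2 := by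
  rw [norm_cutPurity_eq_sum_gram, sum_norm_gram_sq_eq]
  have hsq : ∀ h h' : HighIdx N k → Bool, gramH k ψ ψ h h' * star (gramH k ψ ψ h h') =
      ((‖gramH k ψ ψ h h'‖ ^ 2 : ℝ) : ℂ) := by
    intro h h'
    rw [Complex.star_def, Complex.mul_conj, Complex.normSq_eq_norm_sq, Complex.ofReal_pow]
  simp only [hsq, ← Complex.ofReal_sum]
  rw [Complex.norm_real, Real.norm_of_nonneg]
  exact Finset.sum_nonneg fun _ _ => Finset.sum_nonneg fun _ _ => sq_nonneg _

/-- Complex Cauchy–Schwarz for a finite Hilbert–Schmidt pairing: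
`‖Σ_i X_i · conj Y_i‖ ≤ √(Σ‖X_i‖²) · √(Σ‖Y_i‖²)`. -/
theorem norm_sum_mul_star_le {ι : Type*} (s : Finset ι) (X Y : ι → ℂ) :
    ‖∑ i ∈ s, X i * star (Y i)‖ ≤ Real.sqrt (∑ i ∈ s, ‖X i‖ ^ 2) * Real.sqrt (∑ i ∈ s, ‖Y i‖ ^ 2) := by
  have h1 : ‖∑ i ∈ s, X i * star (Y i)‖ ≤ ∑ i ∈ s, ‖X i‖ * ‖Y i‖ := by
    refine (norm_sum_le _ _).trans (Finset.sum_le_sum fun i _ => ?_)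
    rw [norm_mul, norm_star]
  have h2 : (∑ i ∈ s, ‖X i‖ * ‖Y i‖) ^ 2 ≤ (∑ i ∈ s, ‖X i‖ ^ 2) * ∑ i ∈ s, ‖Y i‖ ^ 2 :=
    Finset.sum_mul_sq_le_sq_mul_sq s _ _
  have h3 : ∑ i ∈ s, ‖X i‖ * ‖Y i‖ ≤ Real.sqrt (∑ i ∈ s, ‖X i‖ ^ 2) * Real.sqrt (∑ i ∈ s, ‖Y i‖ ^ 2) := by
    rw [← Real.sqrt_mul (Finset.sum_nonneg fun _ _ => sq_nonneg _)]
    exact Real.le_sqrt_of_sq_le h2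
  exact h1.trans h3

/-- Same, without the conjugate: `‖Σ_i X_i · Y_i‖ ≤ √(Σ‖X_i‖²) · √(Σ‖Y_i‖²)`. -/
theorem norm_sum_mul_le {ι : Type*} (s : Finset ι) (X Y : ι → ℂ) :
    ‖∑ i ∈ s, X i * Y i‖ ≤ Real.sqrt (∑ i ∈ s, ‖X i‖ ^ 2) * Real.sqrt (∑ i ∈ s, ‖Y i‖ ^ 2) := by
  have h := norm_sum_mul_star_le s X (fun i => star (Y i))
  simp only [star_star, norm_star] at h
  exact h

/-- **Hilbert–Schmidt Cauchy–Schwarz for the Grams**: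
`Σ_{l₁l₂} |(M_aM_b†)_{l₁l₂}|² ≤ √P(a) · √P(b)`. -/
theorem sum_norm_gram_sq_le (k : ℕ) (a b : QReg N → ℂ) :
    ∑ l₁ : LowIdx N k → Bool, ∑ l₂ : LowIdx N k → Bool, ‖gram k a b l₁ l₂‖ ^ 2 ≤
      Real.sqrt ‖cutPurity a k‖ * Real.sqrt ‖cutPurity b k‖ := by
  rw [sum_norm_gram_sq_eq, ← Fintype.sum_prod_type']
  refine (norm_sum_mul_star_le _ _ _).trans (le_of_eq ?_)
  simp only [Fintype.sum_prod_type, ← norm_cutPurity_eq_sum_gramH]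

/-- **The Schatten-4 bound on the 4-linear form**:
`‖fourLin a b c d‖ ≤ (P a)^{1/4} (P b)^{1/4} (P c)^{1/4} (P d)^{1/4}`, written with square roots. -/
theorem norm_fourLin_le (k : ℕ) (a b c d : QReg N → ℂ) :
    ‖fourLin k a b c d‖ ≤ Real.sqrt (Real.sqrt ‖cutPurity a k‖ * Real.sqrt ‖cutPurity b k‖) *
      Real.sqrt (Real.sqrt ‖cutPurity c k‖ * Real.sqrt ‖cutPurity d k‖) := by
  rw [fourLin_eq_sum_gram, ← Fintype.sum_prod_type']
  refine (norm_sum_mul_le _ _ _).trans ?_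
  have hX : ∑ p : (LowIdx N k → Bool) × (LowIdx N k → Bool), ‖gram k a b p.1 p.2‖ ^ 2 ≤
      Real.sqrt ‖cutPurity a k‖ * Real.sqrt ‖cutPurity b k‖ := by
    simp only [Fintype.sum_prod_type]
    exact sum_norm_gram_sq_le k a b
  have hY : ∑ p : (LowIdx N k → Bool) × (LowIdx N k → Bool), ‖gram k c d p.2 p.1‖ ^ 2 ≤
      Real.sqrt ‖cutPurity c k‖ * Real.sqrt ‖cutPurity d k‖ := by
    simp only [Fintype.sum_prod_type]
    calc ∑ l₁ : LowIdx N k → Bool, ∑ l₂ : LowIdx N k → Bool, ‖gram k c d l₂ l₁‖ ^ 2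
        = ∑ l₂ : LowIdx N k → Bool, ∑ l₁ : LowIdx N k → Bool, ‖gram k c d l₂ l₁‖ ^ 2 := Finset.sum_comm
      _ ≤ _ := sum_norm_gram_sq_le k c d
  exact mul_le_mul (Real.sqrt_le_sqrt hX) (Real.sqrt_le_sqrt hY) (Real.sqrt_nonneg _) (Real.sqrt_nonneg _)

/-- If all four purities are `≤ p` then `‖fourLin a b c d‖ ≤ p`. -/
theorem norm_fourLin_le_of_le (k : ℕ) {a b c d : QReg N → ℂ} {p : ℝ}
    (ha : ‖cutPurity a k‖ ≤ p) (hb : ‖cutPurity b k‖ ≤ p) (hc : ‖cutPurity c k‖ ≤ p)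
    (hd : ‖cutPurity d k‖ ≤ p) : ‖fourLin k a b c d‖ ≤ p := by
  have hp : 0 ≤ p := (norm_nonneg _).trans ha
  have hs : ∀ {x : ℝ}, x ≤ p → Real.sqrt x ≤ Real.sqrt p := fun h => Real.sqrt_le_sqrt h
  have h1 : Real.sqrt (Real.sqrt ‖cutPurity a k‖ * Real.sqrt ‖cutPurity b k‖) ≤ Real.sqrt p := by
    calc Real.sqrt (Real.sqrt ‖cutPurity a k‖ * Real.sqrt ‖cutPurity b k‖)
        ≤ Real.sqrt (Real.sqrt p * Real.sqrt p) :=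
          Real.sqrt_le_sqrt (mul_le_mul (hs ha) (hs hb) (Real.sqrt_nonneg _) (Real.sqrt_nonneg _))
      _ = Real.sqrt p := by rw [Real.mul_self_sqrt hp]
  have h2 : Real.sqrt (Real.sqrt ‖cutPurity c k‖ * Real.sqrt ‖cutPurity d k‖) ≤ Real.sqrt p := by
    calc Real.sqrt (Real.sqrt ‖cutPurity c k‖ * Real.sqrt ‖cutPurity d k‖)
        ≤ Real.sqrt (Real.sqrt p * Real.sqrt p) :=
          Real.sqrt_le_sqrt (mul_le_mul (hs hc) (hs hd) (Real.sqrt_nonneg _) (Real.sqrt_nonneg _))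
      _ = Real.sqrt p := by rw [Real.mul_self_sqrt hp]
  calc ‖fourLin k a b c d‖ ≤ _ := norm_fourLin_le k a b c d
    _ ≤ Real.sqrt p * Real.sqrt p := mul_le_mul h1 h2 (Real.sqrt_nonneg _) (Real.sqrt_nonneg _)
    _ = p := Real.mul_self_sqrt hp

/-- **Registered sub-goal `sch_fourLin_bound`** (crux stmt-QuantumAdvantage-10730, line `Sketch`,
ingredient (S) of the torus theorem): the 4-linear agreement form of four vectors on an `N`-qubit
register, each of cut-`k` purity at most `p`, has modulus at most `p`. -/
theorem sch_fourLin_bound :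
    ∀ (N k : ℕ) (a b c d : QReg N → ℂ) (p : ℝ), ‖cutPurity a k‖ ≤ p → ‖cutPurity b k‖ ≤ p → ‖cutPurity c k‖ ≤ p → ‖cutPurity d k‖ ≤ p → ‖∑ x₁ : QReg N, ∑ x₂ : QReg N, ∑ x₃ : QReg N, ∑ x₄ : QReg N, (if (∀ i, k ≤ i.val → x₁ i = x₂ i) ∧ (∀ i, i.val < k → x₂ i = x₃ i) ∧ (∀ i, k ≤ i.val → x₃ i = x₄ i) ∧ (∀ i, i.val < k → x₄ i = x₁ i) then a x₁ * star (b x₂) * c x₃ * star (d x₄) else 0)‖ ≤ p :=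
  fun _ k _ _ _ _ _ ha hb hc hd => norm_fourLin_le_of_le k ha hb hc hd

end Summit.QuantumAdvantage.QuantumAdvantage.Theorems.SymplecticPurity.CompositeFrameBound

end
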